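import Summits.Parity.BatemanHorn.Theorems.SoloInformedTwinUnbalancedLiteBound
import Summits.Parity.BatemanHorn.Theorems.SoloInformedTwinBalancedOnly

/-!
# SoloInformedTwinUnbalancedLite — (F′) in the kernel for `3ε₀ > 1/2 + ε`

Solo unit `solo-Parity-informed` (ideation tier, informed mode), session 80; `paper.md` §20
(Theorem 20.1 = (F′), Corollary 20.4), PLAN §63.3–63.5 ("F5-lite", second half), CLAIMS C144/C154.

With the prose parameters `y = ⌊x^{1-ε}⌋`, `z = ⌊x^{1/2-ε₀}⌋` every cofactor `k` of a switched sum
satisfies `k < (x+2) z / y ≍ x^{1/2-ε₀+ε}`, so for `K = ⌊(x+2)z/y⌋` the side conditions of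
`SoloInformedTwinUnbalancedLiteBound.abs_twinUnbalancedSum_le_of_regime` read
`x^{3/2-3ε₀+ε} (log x)^{2B} ≪ x` and `x^{1-ε₀+ε} ≪ x`, i.e. they hold for all large `x` as soon as
`0 < ε < ε₀ < 1/2` and `1/2 + ε < 3ε₀` (`eventually_liteRegime`).  Consequently

* `twinUnbalancedSum_isLittleO_lite`: `U(x; ⌊x^{1-ε}⌋, ⌊x^{1/2-ε₀}⌋) = o(x)` — the typed premise
  `hU` = (F′) of `twinPrime_iff_balancedSum_rpow` (C137) and `twinPrime_iff_balancedFarTail_rpow`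
  (C120), PROVED for these parameters from Bombieri–Vinogradov for `μ` alone
  (`Literature…BVMoebius.sum_abs_moebiusAPSum_dilate_le`, sorry-free in the tree);
* `twinPrime_iff_balancedSum_rpow_lite`: UNCONDITIONALLY, for `0 < ε < ε₀ < 1/2`, `1/2 + ε < 3ε₀`,
  `π₂(x) ~ 2C₂ x/log²x  ⟺  ∑_{e₁,e₂ > x^{1/2-ε₀}, e₁e₂ > x^{1-ε}} μ(e₁)μ(e₂) log²(e₁e₂) N(e₁,e₂;x) = o(x)`
  — the twin prime asymptotic is EQUIVALENT to cancellation in the balanced pair-Chowla sum alone.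
-/

namespace Summit.Parity.BatemanHorn.Theorems

open Finset Real Filter Asymptotics
open scoped ArithmeticFunction.Moebius
open Literature.NumberTheory.Sieve

/-! ### 1. Eventual comparison of `x^a (log x)^b` with `x^{a'}`, `a < a'` -/

/-- `x^a (log x)^b = o(x^{a'})` for `a < a'`. -/
theorem rpow_mul_log_rpow_isLittleO_rpow {a a' : ℝ} (h : a < a') (b : ℝ) :
    (fun x : ℝ => x ^ a * Real.log x ^ b) =o[atTop] fun x => x ^ a' := by
  have h1 : (fun x : ℝ => Real.log x ^ b) =o[atTop] fun x => x ^ (a' - a) :=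
    isLittleO_log_rpow_rpow_atTop b (by linarith)
  have h2 : (fun x : ℝ => x ^ a) =O[atTop] fun x => x ^ a := isBigO_refl _ _
  refine (h2.mul_isLittleO h1).congr' EventuallyEq.rfl ?_
  filter_upwards [eventually_gt_atTop 0] with x hx
  rw [← Real.rpow_add hx]
  ring_nf

/-- Eventually `M x^a (log x)^b ≤ c x^{a'}` (`a < a'`, `c > 0`, any `M`, `b`). -/
theorem eventually_mul_rpow_mul_log_rpow_le {a a' : ℝ} (h : a < a') (b M : ℝ) {c : ℝ}
    (hc : 0 < c) : ∀ᶠ x : ℝ in atTop, M * x ^ a * Real.log x ^ b ≤ c * x ^ a' := by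
  rcases le_or_gt M 0 with hM | hM
  · filter_upwards [eventually_ge_atTop 1] with x hx1
    have hx0 : 0 ≤ x := by linarith
    have h0 : 0 ≤ x ^ a * Real.log x ^ b :=
      mul_nonneg (Real.rpow_nonneg hx0 a) (Real.rpow_nonneg (Real.log_nonneg hx1) b)
    have h1 : M * x ^ a * Real.log x ^ b ≤ 0 := by
      rw [mul_assoc]; exact mul_nonpos_of_nonpos_of_nonneg hM h0
    exact h1.trans (mul_nonneg hc.le (Real.rpow_nonneg hx0 _))
  · filter_upwards [(rpow_mul_log_rpow_isLittleO_rpow h b).bound (div_pos hc hM),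
      eventually_ge_atTop 1] with x hx hx1
    have hx0 : 0 ≤ x := by linarith
    rw [Real.norm_eq_abs, Real.norm_eq_abs, abs_of_nonneg (mul_nonneg (Real.rpow_nonneg hx0 _)
      (Real.rpow_nonneg (Real.log_nonneg hx1) _)), abs_of_nonneg (Real.rpow_nonneg hx0 _)] at hx
    calc M * x ^ a * Real.log x ^ b = M * (x ^ a * Real.log x ^ b) := by ring
      _ ≤ M * (c / M * x ^ a') := mul_le_mul_of_nonneg_left hx hM.le
      _ = c * x ^ a' := by field_simp

/-! ### 2. The prose parameters eventually lie in regime (1a) -/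

/-- For `0 < ε < ε₀ < 1/2`, `1/2 + ε < 3ε₀` and any `B > 0`, `X₀`: for all large `x`, with
`y = ⌊x^{1-ε}⌋`, `z = ⌊x^{1/2-ε₀}⌋`, `K = ⌊(x+2)z/y⌋`, one has `x ≥ X₀`, `z² ≤ y`, `z ≤ x`,
`(x+2)z ≤ (K+1)y`, `K (2z log^B(x+2))² ≤ ⌊x/2⌋` and `K (x+2)^{1/2} ≤ ⌊x/2⌋`. -/
theorem eventually_liteRegime {ε ε₀ : ℝ} (hε : 0 < ε) (hε₀ : ε < ε₀) (hε₀' : ε₀ < 1 / 2)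
    (h3 : 1 / 2 + ε < 3 * ε₀) {B : ℝ} (hB : 0 < B) (X₀ : ℝ) :
    ∀ᶠ x : ℕ in atTop, X₀ ≤ (x : ℝ) ∧
      balanceCut ε₀ x * balanceCut ε₀ x ≤ rpowCut ε x ∧ balanceCut ε₀ x ≤ x ∧
      (x + 2) * balanceCut ε₀ x ≤ ((x + 2) * balanceCut ε₀ x / rpowCut ε x + 1) * rpowCut ε x ∧
      (((x + 2) * balanceCut ε₀ x / rpowCut ε x : ℕ) : ℝ)
          * (2 * (balanceCut ε₀ x : ℝ) * Real.log ((x : ℝ) + 2) ^ B) ^ 2 ≤ ((x / 2 : ℕ) : ℝ) ∧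
      (((x + 2) * balanceCut ε₀ x / rpowCut ε x : ℕ) : ℝ) * ((x : ℝ) + 2) ^ (1 / 2 : ℝ)
          ≤ ((x / 2 : ℕ) : ℝ) := by
  -- the real-variable facts
  have f3 : ∀ᶠ t : ℝ in atTop, 2 ≤ t ^ (1 - ε) :=
    (tendsto_rpow_atTop (by linarith)).eventually_ge_atTop 2
  have f4 : ∀ᶠ t : ℝ in atTop, 1 * t ^ (1 - 2 * ε₀) * Real.log t ^ (0 : ℝ)
      ≤ (1 / 2) * t ^ (1 - ε) :=
    eventually_mul_rpow_mul_log_rpow_le (by linarith) 0 1 (by norm_num)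
  have f5 : ∀ᶠ t : ℝ in atTop,
      (24 * ((2 : ℝ) ^ B) ^ 2) * t ^ ((1 / 2 - ε₀ + ε) + (1 / 2 - ε₀) * 2) * Real.log t ^ (B * 2)
        ≤ (1 / 4) * t ^ (1 : ℝ) :=
    eventually_mul_rpow_mul_log_rpow_le (by linarith) _ _ (by norm_num)
  have f6 : ∀ᶠ t : ℝ in atTop,
      12 * t ^ ((1 / 2 - ε₀ + ε) + 1 / 2) * Real.log t ^ (0 : ℝ) ≤ (1 / 4) * t ^ (1 : ℝ) :=
    eventually_mul_rpow_mul_log_rpow_le (by linarith) _ _ (by norm_num)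
  have hev := tendsto_natCast_atTop_atTop.eventually
    ((eventually_ge_atTop X₀).and ((eventually_ge_atTop 4).and (f3.and (f4.and (f5.and f6)))))
  filter_upwards [hev] with x hx
  obtain ⟨h1, h4t, h3t, h4', h5', h6'⟩ := hx
  -- notation and basic bounds
  set t : ℝ := (x : ℝ) with htdef
  have ht1 : 1 ≤ t := by linarith
  have ht0 : 0 < t := by linarith
  have hl0 : 0 ≤ Real.log t := Real.log_nonneg ht1
  simp only [Real.rpow_zero, mul_one, one_mul, Real.rpow_one] at h4' h6' h5'
  have hydef : rpowCut ε x = ⌊t ^ (1 - ε)⌋₊ := rfl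
  have hzdef : balanceCut ε₀ x = ⌊t ^ (1 / 2 - ε₀)⌋₊ := rfl
  set y : ℕ := rpowCut ε x with hy
  set z : ℕ := balanceCut ε₀ x with hz
  have hy_le : (y : ℝ) ≤ t ^ (1 - ε) := by rw [hydef]; exact Nat.floor_le (Real.rpow_nonneg ht0.le _)
  have hy_gt : t ^ (1 - ε) - 1 < y := by rw [hydef]; exact Nat.sub_one_lt_floor _
  have hy2 : t ^ (1 - ε) / 2 ≤ y := by linarith
  have hy1 : (1 : ℝ) ≤ y := by linarith
  have hy0 : 0 < y := by exact_mod_cast (show (0 : ℝ) < y by linarith)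
  have hy0' : (0 : ℝ) < t ^ (1 - ε) / 2 := by linarith
  have hz_le : (z : ℝ) ≤ t ^ (1 / 2 - ε₀) := by
    rw [hzdef]; exact Nat.floor_le (Real.rpow_nonneg ht0.le _)
  have hz0 : (0 : ℝ) ≤ z := Nat.cast_nonneg z
  have hta0 : 0 ≤ t ^ (1 / 2 - ε₀) := Real.rpow_nonneg ht0.le _
  -- `⌊x/2⌋ ≥ (t-1)/2 ≥ t/4`
  have hhalf : (t - 1) / 2 ≤ ((x / 2 : ℕ) : ℝ) := by
    have : (x : ℝ) ≤ 2 * ((x / 2 : ℕ) : ℝ) + 1 := by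
      exact_mod_cast (show x ≤ 2 * (x / 2) + 1 by omega)
    rw [htdef]; linarith
  have hquarter : t / 4 ≤ ((x / 2 : ℕ) : ℝ) := by linarith
  -- the cofactor bound `K ≤ 6 t^{1/2-ε₀+ε}`
  set K : ℕ := (x + 2) * z / y with hK
  have hKle : (K : ℝ) ≤ 6 * t ^ (1 / 2 - ε₀ + ε) := by
    have hnum : ((x + 2 : ℕ) : ℝ) * z ≤ 3 * t * t ^ (1 / 2 - ε₀) := by
      push_cast
      exact mul_le_mul (by rw [htdef]; linarith) hz_le hz0 (by linarith)
    calc (K : ℝ) ≤ (((x + 2) * z : ℕ) : ℝ) / (y : ℕ) := Nat.cast_div_le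
      _ = ((x + 2 : ℕ) : ℝ) * z / y := by push_cast; ring
      _ ≤ 3 * t * t ^ (1 / 2 - ε₀) / (t ^ (1 - ε) / 2) :=
          div_le_div₀ (by positivity) hnum hy0' hy2
      _ = 6 * (t * t ^ (1 / 2 - ε₀) / t ^ (1 - ε)) := by
          rw [div_div_eq_mul_div]; ring
      _ = 6 * t ^ (1 / 2 - ε₀ + ε) := by
          rw [show (1 : ℝ) / 2 - ε₀ + ε = (1 + (1 / 2 - ε₀)) - (1 - ε) by ring,
            Real.rpow_sub ht0 (1 + (1 / 2 - ε₀)) (1 - ε), Real.rpow_add ht0 1 (1 / 2 - ε₀),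
            Real.rpow_one]
  have hK0 : (0 : ℝ) ≤ K := Nat.cast_nonneg K
  refine ⟨h1, ?_, ?_, ?_, ?_, ?_⟩
  · -- `z² ≤ y`
    have : (z : ℝ) * z ≤ y := by
      calc (z : ℝ) * z ≤ t ^ (1 / 2 - ε₀) * t ^ (1 / 2 - ε₀) := mul_le_mul hz_le hz_le hz0 hta0
        _ = t ^ (1 - 2 * ε₀) := by
            rw [← Real.rpow_add ht0]; ring_nf
        _ ≤ 1 / 2 * t ^ (1 - ε) := h4'
        _ ≤ y := by linarith
    exact_mod_cast this
  · -- `z ≤ x`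
    have : (z : ℝ) ≤ t := by
      refine hz_le.trans ?_
      calc t ^ (1 / 2 - ε₀) ≤ t ^ (1 : ℝ) := Real.rpow_le_rpow_of_exponent_le ht1 (by linarith)
        _ = t := Real.rpow_one t
    rw [htdef] at this
    exact_mod_cast this
  · -- `(x+2) z ≤ (K+1) y`
    have := @Nat.lt_div_mul_add ((x + 2) * z) y hy0
    rw [add_one_mul]
    exact this.le
  · -- regime (1a), first condition
    have hlog2 : Real.log (t + 2) ≤ 2 * Real.log t := by
      have h := Real.log_le_log (by linarith : 0 < t + 2) (show t + 2 ≤ t ^ 2 by nlinarith)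
      rw [Real.log_pow] at h
      push_cast at h
      exact h
    have hl2_0 : 0 ≤ Real.log (t + 2) := Real.log_nonneg (by linarith)
    have hLB : Real.log (t + 2) ^ B ≤ (2 : ℝ) ^ B * Real.log t ^ B := by
      rw [← Real.mul_rpow (by norm_num) hl0]
      exact Real.rpow_le_rpow hl2_0 hlog2 hB.le
    have hLB0 : 0 ≤ Real.log (t + 2) ^ B := Real.rpow_nonneg hl2_0 _
    have hin0 : 0 ≤ 2 * (z : ℝ) * Real.log (t + 2) ^ B := by positivity
    have hin : 2 * (z : ℝ) * Real.log (t + 2) ^ B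
        ≤ 2 * t ^ (1 / 2 - ε₀) * ((2 : ℝ) ^ B * Real.log t ^ B) :=
      mul_le_mul (mul_le_mul_of_nonneg_left hz_le (by norm_num)) hLB hLB0 (by positivity)
    have hsq1 : (t ^ (1 / 2 - ε₀)) ^ 2 = t ^ ((1 / 2 - ε₀) * 2) := by
      rw [Real.rpow_mul ht0.le, Real.rpow_two]
    have hsq2 : (Real.log t ^ B) ^ 2 = Real.log t ^ (B * 2) := by
      rw [Real.rpow_mul hl0, Real.rpow_two]
    calc (K : ℝ) * (2 * (z : ℝ) * Real.log (t + 2) ^ B) ^ 2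
        ≤ 6 * t ^ (1 / 2 - ε₀ + ε) * (2 * t ^ (1 / 2 - ε₀) * ((2 : ℝ) ^ B * Real.log t ^ B)) ^ 2 :=
          mul_le_mul hKle (pow_le_pow_left₀ hin0 hin 2) (by positivity) (by positivity)
      _ = 24 * ((2 : ℝ) ^ B) ^ 2 * (t ^ (1 / 2 - ε₀ + ε) * (t ^ (1 / 2 - ε₀)) ^ 2)
            * (Real.log t ^ B) ^ 2 := by ring
      _ = 24 * ((2 : ℝ) ^ B) ^ 2 * t ^ ((1 / 2 - ε₀ + ε) + (1 / 2 - ε₀) * 2)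
            * Real.log t ^ (B * 2) := by
          rw [hsq1, hsq2, ← Real.rpow_add ht0]
      _ ≤ 1 / 4 * t := h5'
      _ = t / 4 := by ring
      _ ≤ ((x / 2 : ℕ) : ℝ) := hquarter
  · -- regime (1a), second condition
    have hsqrt : (t + 2) ^ (1 / 2 : ℝ) ≤ 2 * t ^ (1 / 2 : ℝ) := by
      rw [← Real.sqrt_eq_rpow, ← Real.sqrt_eq_rpow]
      have h4 : Real.sqrt 4 = 2 := by
        rw [show (4 : ℝ) = 2 * 2 by norm_num]; exact Real.sqrt_mul_self (by norm_num)
      calc Real.sqrt (t + 2) ≤ Real.sqrt (4 * t) := Real.sqrt_le_sqrt (by linarith)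
        _ = 2 * Real.sqrt t := by rw [Real.sqrt_mul (by norm_num), h4]
    calc (K : ℝ) * (t + 2) ^ (1 / 2 : ℝ)
        ≤ 6 * t ^ (1 / 2 - ε₀ + ε) * (2 * t ^ (1 / 2 : ℝ)) :=
          mul_le_mul hKle hsqrt (Real.rpow_nonneg (by linarith) _) (by positivity)
      _ = 12 * (t ^ (1 / 2 - ε₀ + ε) * t ^ (1 / 2 : ℝ)) := by ring
      _ = 12 * t ^ ((1 / 2 - ε₀ + ε) + 1 / 2) := by rw [← Real.rpow_add ht0]
      _ ≤ 1 / 4 * t := h6'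
      _ = t / 4 := by ring
      _ ≤ ((x / 2 : ℕ) : ℝ) := hquarter

/-! ### 3. (F′) for `3ε₀ > 1/2 + ε`, and the unconditional headline -/

/-- **(F′) in the kernel for `3ε₀ > 1/2 + ε`.**  For `0 < ε < ε₀ < 1/2` with `1/2 + ε < 3ε₀`:
`U(x; ⌊x^{1-ε}⌋, ⌊x^{1/2-ε₀}⌋) = o(x)` — the unbalanced pairs `min(e₁,e₂) ≤ x^{1/2-ε₀}` of the
located twin sum contribute `o(x)`.  Bombieri–Vinogradov for `μ` is the only analytic input. -/
theorem twinUnbalancedSum_isLittleO_lite {ε ε₀ : ℝ} (hε : 0 < ε) (hε₀ : ε < ε₀)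
    (hε₀' : ε₀ < 1 / 2) (h3 : 1 / 2 + ε < 3 * ε₀) :
    (fun x => twinUnbalancedSum x (rpowCut ε x) (balanceCut ε₀ x)) =o[atTop] fun x : ℕ => (x : ℝ) := by
  obtain ⟨B, C, X₀, hB, hC, hmain⟩ := abs_twinUnbalancedSum_le_of_regime 1 one_pos
  refine isLittleO_iff.2 fun c hc => ?_
  have hlog : ∀ᶠ x : ℕ in atTop, C / c ≤ Real.log (x : ℝ) :=
    (Real.tendsto_log_atTop.comp tendsto_natCast_atTop_atTop).eventually_ge_atTop _
  filter_upwards [eventually_liteRegime hε hε₀ hε₀' h3 hB X₀, hlog, eventually_ge_atTop 2]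
    with x hx hlx hx2
  obtain ⟨h1, h2, h3', h4, h5, h6⟩ := hx
  have hU := hmain x (rpowCut ε x) (balanceCut ε₀ x)
    ((x + 2) * balanceCut ε₀ x / rpowCut ε x) h1 h2 h3' h4 h5 h6
  have hx0 : (0 : ℝ) < x := by exact_mod_cast (show 0 < x by omega)
  have hl0 : 0 < Real.log (x : ℝ) := Real.log_pos (by exact_mod_cast (show 1 < x by omega))
  rw [Real.rpow_one] at hU
  rw [Real.norm_eq_abs, Real.norm_eq_abs, abs_of_pos hx0]
  have hCc : C ≤ Real.log (x : ℝ) * c := (div_le_iff₀ hc).mp hlx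
  calc |twinUnbalancedSum x (rpowCut ε x) (balanceCut ε₀ x)| ≤ C * x / Real.log x := hU
    _ ≤ c * x := by
        rw [div_le_iff₀ hl0]
        nlinarith [mul_le_mul_of_nonneg_right hCc hx0.le]

/-- **Unconditional headline (paper.md Cor. 20.4 with (F′) discharged, `3ε₀ > 1/2 + ε`).**
For `0 < ε < ε₀ < 1/2` with `1/2 + ε < 3ε₀` (e.g. `ε = 1/100`, `ε₀ = 1/5`):
`π₂(x) ~ 2C₂ x/log²x  ⟺  ∑_{e₁,e₂ > x^{1/2-ε₀}, e₁e₂ > x^{1-ε}} μ(e₁)μ(e₂) log²(e₁e₂) N(e₁,e₂;x) = o(x)`,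
`N(e₁,e₂;x) = #{n ≤ x odd : e₁ ∣ n, e₂ ∣ n+2} + #{m ≤ x/2 : e₁ ∣ m, e₂ ∣ m+1}`.  No hypothesis. -/
theorem twinPrime_iff_balancedSum_rpow_lite {ε ε₀ : ℝ} (hε : 0 < ε) (hε₀ : ε < ε₀)
    (hε₀' : ε₀ < 1 / 2) (h3 : 1 / 2 + ε < 3 * ε₀) :
    (fun x : ℕ => (twinPrimeCount x : ℝ)) ~[atTop]
        (fun x : ℕ => 2 * twinPrimeConst * x / Real.log x ^ 2) ↔
      (fun x => twinBalancedFarSum x (rpowCut ε x) (balanceCut ε₀ x) (rpowCut ε x))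
        =o[atTop] fun x : ℕ => (x : ℝ) :=
  twinPrime_iff_balancedSum_rpow hε (by linarith) ε₀ (twinUnbalancedSum_isLittleO_lite hε hε₀ hε₀' h3)

/-- **The same with a product window (paper.md Cor. 20.3 with (F′) discharged).**  For
`0 < ε < ε₀ < 1/2`, `1/2 + ε < 3ε₀`, any `η`, under the ONE remaining prose premise `hW` = (F)
(the balanced window `x^{1-ε} < e₁e₂ ≤ x^{1+η}` is `o(x)`; NOT proved in the kernel):
`π₂(x) ~ 2C₂ x/log²x ⟺` the balanced far tail `e₁e₂ > x^{1+η}` is `o(x)`. -/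
theorem twinPrime_iff_balancedFarTail_rpow_lite {ε ε₀ : ℝ} (hε : 0 < ε) (hε₀ : ε < ε₀)
    (hε₀' : ε₀ < 1 / 2) (h3 : 1 / 2 + ε < 3 * ε₀) {η : ℝ}
    (hW : (fun x => twinBalancedWindowSum x (rpowCut ε x) (balanceCut ε₀ x) (productLevel η x))
      =o[atTop] fun x : ℕ => (x : ℝ)) :
    (fun x : ℕ => (twinPrimeCount x : ℝ)) ~[atTop]
        (fun x : ℕ => 2 * twinPrimeConst * x / Real.log x ^ 2) ↔
      (fun x => twinBalancedFarSum x (rpowCut ε x) (balanceCut ε₀ x) (productLevel η x))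
        =o[atTop] fun x : ℕ => (x : ℝ) :=
  twinPrime_iff_balancedFarTail_rpow hε (by linarith)
    (twinUnbalancedSum_isLittleO_lite hε hε₀ hε₀' h3) hW

end Summit.Parity.BatemanHorn.Theorems
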